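import Summits.QuantumFields.BalabanUV.T4Continuum.Support.DirichletFreeTower

/-!
# T⁴ programme, spine node NE2 (U1a), sub-row Δ1 «NE2⁰-Dirichlet» — THE Ω-RESTRICTED VECTOR TOWER FOR AN ARBITRARY REGION OPERATOR:
# gen 11's `DirichletFreeTower` assembly ABSTRACTED OVER THE OPERATOR FAMILY — for ANY Hermitian `D k` on the region carriers `ridx S₀ k`,
# King's compressed averaging/planting give `FreeTowerLaws` with every bookkeeping field PROVED and the THREE ANALYTIC INPUTS DISPLAYED
# (W1 coercivity, W2 gradient-form bound, W3 injected law); the torus-gauge model `DalevR` is the instance where W1/W2 are theorems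

Twelfth generation of the NE2 prover lineage P1 of the cell `pub-balaban` (row NE2 owner), file 7 (owner item O12-g′ of ruling R23, the
operator-generic half; the instance half — the [B9]-faithful `U = 1` vector region operator (3.26)–(3.27) with the REGION gauge co-projection
(3.25) — is the crew's Δ1-COERC line, leaf-07 gen 5: `Support/RegionGaugeSlice` (coercivity ⟺ ONE slice inequality), `Support/RegionScalarCompression`,
instance `Support/RegionGaugeFixedVector` in flight).  Gen 11 (`Support/DirichletFreeTower`) proved the Ω-restricted `FreeTowerLaws` for the
ONE family `DalevR S₀` (B5's torus `Δ_a` compressed — the torus-gauge MODEL of the located delta G-ne2p1-g12-1), using two analytic facts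
that hold for THAT operator: coercivity and the gradient-form bound (both from B5's (1.89), `DirichletRegionTower.coercive_calDalev` /
`nsq_fdiff_le_form`).  THIS FILE re-runs the assembly for an ARBITRARY operator family on the SAME carriers, with those two facts and the
injected law as DISPLAYED binders — so that any faithful region operator typed on `ridx S₀ k` lands on the tower by supplying exactly W1–W3:

 * §1 the zero-extended Green function `extGD D k = selᴴ·(D (k+1))⁻¹·sel` and **`opNorm_fdiff_mul_extGD_le`**: W1 `Coercive (D (k+1)) γ` + W2
   `‖∇_ν ext(w)‖² ≤ Cg·Re⟨w, D (k+1) w⟩` ⟹ `‖∇_ν·extGD‖ ≤ √(Cg·γ⁻¹)`; block Poincaré ⟹ `‖(1 − Π)·extGD‖ ≤ 2d√(Cg·γ⁻¹)·L^{−k}`;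
   **`complement_le_of`**: `‖(D (k+1))⁻¹·(1 − J_kJ_kᴴ)_{ΩΩ}‖ ≤ 2d√(Cg·γ⁻¹)·L^{−k}` (Hermitian `D (k+1)`).
 * §2 THE END **`freeTowerLaws_region_of (hherm) (hγ) (hCg) (hcoer) (hgrad) (hinj)`**: `FreeTowerLaws D (QlevR S₀) (JpcTR S₀) 0 L^d
   (2d√(Cg·γ⁻¹)·L^{−k}) e₁ 0`; **`towerLimitRate_region_of`** (rate `θ ∈ [L⁻¹,1)` for `e₁ k ≤ C₁θ^k`); **`towerLimitRate_region_perturbed_of`**.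
   W2 may be supplied with a LEVEL-DEPENDENT constant by instantiating `Cg` per level outside this file (the crew's Δ1-COERC memo locates a
   corner gauge mode of the faithful operator on regions with re-entrant edges: `⟨A,Δ_aA⟩ = O(1)`, `‖∇A‖² ∼ η^{−2/3}` — there a uniform W2 is a
   BOX-type input; the complement defect `2d√(Cg_k·γ⁻¹)·L^{−k}` stays geometric).
 * §3 CONSISTENCY (kernel): the torus-gauge model `D = DalevR S₀` satisfies W1 with `γ = ((d+1)Cst)⁻¹` and W2 with `Cg = (d+1)Cst` as THEOREMS
   (`coercive_DalevR`, `grad_form_DalevR`), and `freeTowerLaws_region_of` then gives gen 11's laws with complement constant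
   `2d√((d+1)Cst·(((d+1)Cst)⁻¹)⁻¹) = 2d(d+1)Cst` (`freeTowerLaws_dalevR_of_injected'`).

HONEST FRAMING (T4-DAG p. 1).  `U = 1` bookkeeping ([folklore]); ONE region (gen 11's site-based `inReg S₀`), ONE averaging scale; finite
torus; linear layer; operator norm; every analytic input DISPLAYED; NE2 (U1a) NOT proved; spine 0/9 unchanged; NOT [B9] (3.23)–(3.27) as
printed; NOT infinite volume, NOT a mass gap, NOT the Clay problem, NOT summit progress.  HONEST DEPENDENCY: continuum YM on T⁴ ⇐ BetaPertH ∧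
nine spine estimates (0/9 proved); BetaPertH ⇐ (D1) ∧ (D4) ∧ CAP+tail; G-an2-4 gates asym, D1 and NE2/3/4.  No `sorry`.
-/

noncomputable section

open scoped BigOperators ComplexConjugate Matrix Matrix.Norms.L2Operator
open Filter Topology

namespace Summit.QuantumFields.BalabanUV.T4Continuum.DirichletRegionTowerOf

open Literature.MathematicalPhysics.QuantumFieldTheory.Balaban1983to89.B5Prop11Plancherel (Cst Cst_nonneg Tor fine fdiff shiftM
  opNorm_le_of_sq_le)
open Literature.MathematicalPhysics.QuantumFieldTheory.Balaban1983to89.B5Prop11Lower (nsq nsq_nonneg norm_star_dotProduct_le nsq_mulVec_le)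
open Literature.MathematicalPhysics.QuantumFieldTheory.Balaban1983to89.B5G183RateUnitTower (lev lev_neZero)
open Summit.QuantumFields.BalabanUV.T4Continuum
open Summit.QuantumFields.BalabanUV.T4Continuum.CovariantAveragingTower (TowerLimitRate)
open Summit.QuantumFields.BalabanUV.T4Continuum.BalabanAveragedTowerUnit (idx Qlev one_le_lev' cast_lev')
open Summit.QuantumFields.BalabanUV.T4Continuum.BalabanBlockPoincare (Pi opNorm_one_sub_Pi_mul_le opNorm_shiftM_sub_one_mul_le)
open Summit.QuantumFields.BalabanUV.T4Continuum.BackgroundResolventTower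
open Summit.QuantumFields.BalabanUV.T4Continuum.KingPairingPlantedLaw (JpcT calDalev)
open Summit.QuantumFields.BalabanUV.T4Continuum.SubtypeCompression
open Summit.QuantumFields.BalabanUV.T4Continuum.DirichletRegionTower
open Summit.QuantumFields.BalabanUV.T4Continuum.DirichletFreeTower (JpcTR_mul_conjTranspose one_sub_Pi_vanish₂)
open Summit.QuantumFields.BalabanUV.T4Continuum.PerturbationAlgebra (perturbationLaws_zero)

variable {d : ℕ} (L : ℕ) [NeZero L] (M : Fin d → ℕ) [hM : ∀ μ, NeZero (M μ)] (S₀ : idx L M 0 → Prop) [DecidablePred S₀]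
variable (D : (k : ℕ) → Matrix (ridx L M S₀ k) (ridx L M S₀ k) ℂ)

/-! ## §1 The complement law for an arbitrary region operator, from W1 + W2 -/

section Complement

variable (k : ℕ)

/-- the zero-extended Green function `selᴴ·(D (k+1))⁻¹·sel` on the whole fine torus. [folklore] -/
def extGD : Matrix (idx L M (k + 1)) (idx L M (k + 1)) ℂ :=
  (sel (inReg L M S₀ (k + 1)))ᴴ * (D (k + 1))⁻¹ * sel (inReg L M S₀ (k + 1))

/-- its action: restrict, apply `(D (k+1))⁻¹`, extend by zero. [folklore] -/
theorem extGD_mulVec (y : idx L M (k + 1) → ℂ) :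
    extGD L M S₀ D k *ᵥ y = ext (inReg L M S₀ (k + 1)) ((D (k + 1))⁻¹ *ᵥ fun z : ridx L M S₀ (k + 1) => y z) := by
  set p := inReg L M S₀ (k + 1)
  have h1 : sel p *ᵥ y = fun z : ridx L M S₀ (k + 1) => y z := by
    funext z
    simp only [Matrix.mulVec, dotProduct, sel, ite_mul, one_mul, zero_mul, Finset.sum_ite_eq, Finset.mem_univ, if_true]
  have h2 : ∀ w : ridx L M S₀ (k + 1) → ℂ, (sel p)ᴴ *ᵥ w = ext p w := by
    intro w
    funext i
    simp only [Matrix.mulVec, dotProduct, Matrix.conjTranspose_apply, sel, apply_ite star, star_one, star_zero, ite_mul,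
      one_mul, zero_mul, ext]
    by_cases hi : p i
    · rw [dif_pos hi, Finset.sum_eq_single ⟨i, hi⟩]
      · simp
      · intro b _ hb
        rw [if_neg]
        intro h; exact hb (Subtype.ext h)
      · intro h; exact absurd (Finset.mem_univ _) h
    · rw [dif_neg hi]
      refine Finset.sum_eq_zero fun b _ => ?_
      rw [if_neg]
      intro h; exact hi (h ▸ b.2)
  rw [extGD, ← Matrix.mulVec_mulVec, ← Matrix.mulVec_mulVec, h1, h2]

/-- **THE GRADIENT BOUND from W1 + W2**: `‖∇_ν · extGD‖ ≤ √(Cg·γ⁻¹)`. [folklore] -/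
theorem opNorm_fdiff_mul_extGD_le {γ Cg : ℝ} (hγ : 0 < γ) (hCg : 0 ≤ Cg) (hcoer : Coercive (D (k + 1)) γ)
    (hgrad : ∀ (ν : Fin d) (w : ridx L M S₀ (k + 1) → ℂ),
      nsq (fdiff (fine (lev L (k + 1)) M) ((lev L (k + 1) : ℕ) : ℂ) ν *ᵥ ext (inReg L M S₀ (k + 1)) w)
        ≤ Cg * (star w ⬝ᵥ (D (k + 1) *ᵥ w)).re) (ν : Fin d) :
    ‖fdiff (fine (lev L (k + 1)) M) ((lev L (k + 1) : ℕ) : ℂ) ν * extGD L M S₀ D k‖ ≤ Real.sqrt (Cg * γ⁻¹) := by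
  set p := inReg L M S₀ (k + 1) with hp
  set Dk := D (k + 1) with hDk
  have hU : IsUnit Dk.det := isUnit_det_of_coercive hγ hcoer
  have hG : ‖Dk⁻¹‖ ≤ γ⁻¹ := opNorm_inv_le_of_coercive hγ hcoer
  refine opNorm_le_of_sq_le _ (Real.sqrt_nonneg _) fun y => ?_
  set w : ridx L M S₀ (k + 1) → ℂ := fun z => y z with hw
  set v : ridx L M S₀ (k + 1) → ℂ := Dk⁻¹ *ᵥ w with hv
  have e1 : ∑ i, ‖∑ j, (fdiff (fine (lev L (k + 1)) M) ((lev L (k + 1) : ℕ) : ℂ) ν * extGD L M S₀ D k) i j * y j‖ ^ 2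
      = nsq (fdiff (fine (lev L (k + 1)) M) ((lev L (k + 1) : ℕ) : ℂ) ν *ᵥ ext p v) := by
    have e0 : ∑ i, ‖∑ j, (fdiff (fine (lev L (k + 1)) M) ((lev L (k + 1) : ℕ) : ℂ) ν * extGD L M S₀ D k) i j * y j‖ ^ 2
        = nsq ((fdiff (fine (lev L (k + 1)) M) ((lev L (k + 1) : ℕ) : ℂ) ν * extGD L M S₀ D k) *ᵥ y) := rfl
    rw [e0, ← Matrix.mulVec_mulVec, extGD_mulVec]
  have e2 : ∑ j, ‖y j‖ ^ 2 = nsq y := rfl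
  rw [e1, e2, Real.sq_sqrt (mul_nonneg hCg (inv_nonneg.mpr hγ.le))]
  have h1 := hgrad ν v
  have hDv : Dk *ᵥ v = w := by
    rw [hv, Matrix.mulVec_mulVec, Matrix.mul_nonsing_inv _ hU, Matrix.one_mulVec]
  rw [hDv] at h1
  have h3 : (star v ⬝ᵥ w).re ≤ Real.sqrt (nsq v) * Real.sqrt (nsq w) :=
    (Complex.re_le_norm _).trans (norm_star_dotProduct_le v w)
  have h4 : nsq v ≤ γ⁻¹ ^ 2 * nsq w :=
    (nsq_mulVec_le Dk⁻¹ w).trans (mul_le_mul_of_nonneg_right (pow_le_pow_left₀ (norm_nonneg _) hG 2) (nsq_nonneg _))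
  have h5 : Real.sqrt (nsq v) ≤ γ⁻¹ * Real.sqrt (nsq w) := by
    rw [← Real.sqrt_sq (inv_nonneg.mpr hγ.le), ← Real.sqrt_mul (sq_nonneg _)]
    exact Real.sqrt_le_sqrt h4
  have h6 : nsq w ≤ nsq y := by
    rw [hw]; unfold nsq
    rw [← Fintype.sum_subtype_add_sum_subtype p (fun i => ‖y i‖ ^ 2)]
    exact le_add_of_nonneg_right (Finset.sum_nonneg fun _ _ => by positivity)
  have hsw : Real.sqrt (nsq w) * Real.sqrt (nsq w) = nsq w := Real.mul_self_sqrt (nsq_nonneg _)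
  calc nsq (fdiff (fine (lev L (k + 1)) M) ((lev L (k + 1) : ℕ) : ℂ) ν *ᵥ ext p v)
      ≤ Cg * (star v ⬝ᵥ w).re := h1
    _ ≤ Cg * (Real.sqrt (nsq v) * Real.sqrt (nsq w)) := mul_le_mul_of_nonneg_left h3 hCg
    _ ≤ Cg * (γ⁻¹ * Real.sqrt (nsq w) * Real.sqrt (nsq w)) :=
        mul_le_mul_of_nonneg_left (mul_le_mul_of_nonneg_right h5 (Real.sqrt_nonneg _)) hCg
    _ = Cg * γ⁻¹ * nsq w := by rw [mul_assoc γ⁻¹, hsw]; ring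
    _ ≤ Cg * γ⁻¹ * nsq y := mul_le_mul_of_nonneg_left h6 (mul_nonneg hCg (inv_nonneg.mpr hγ.le))

/-- hence the block Poincaré inequality: `‖(1 − Π)·extGD‖ ≤ 2d√(Cg·γ⁻¹)·L^{−k}`. [folklore] -/
theorem opNorm_one_sub_Pi_mul_extGD_le {γ Cg : ℝ} (hγ : 0 < γ) (hCg : 0 ≤ Cg) (hcoer : Coercive (D (k + 1)) γ)
    (hgrad : ∀ (ν : Fin d) (w : ridx L M S₀ (k + 1) → ℂ),
      nsq (fdiff (fine (lev L (k + 1)) M) ((lev L (k + 1) : ℕ) : ℂ) ν *ᵥ ext (inReg L M S₀ (k + 1)) w)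
        ≤ Cg * (star w ⬝ᵥ (D (k + 1) *ᵥ w)).re) :
    ‖(1 - PiT L M k) * extGD L M S₀ D k‖ ≤ 2 * d * Real.sqrt (Cg * γ⁻¹) * ((L : ℝ)⁻¹) ^ k := by
  have hc : (((lev L (k + 1) : ℕ) : ℂ)) ≠ 0 := by exact_mod_cast (NeZero.ne (lev L (k + 1)))
  have hδ : ∀ ν, ‖(shiftM (fine (lev L (k + 1)) M) ν - 1) * extGD L M S₀ D k‖
      ≤ Real.sqrt (Cg * γ⁻¹) / ‖(((lev L (k + 1) : ℕ) : ℂ))‖ :=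
    fun ν => opNorm_shiftM_sub_one_mul_le _ hc ν (opNorm_fdiff_mul_extGD_le L M S₀ D k hγ hCg hcoer hgrad ν)
  have hn : ‖(((lev L (k + 1) : ℕ) : ℂ))‖ = (L : ℝ) ^ (k + 1) := by
    rw [Complex.norm_natCast, cast_lev']
  rw [hn] at hδ
  have hδ0 : 0 ≤ Real.sqrt (Cg * γ⁻¹) / (L : ℝ) ^ (k + 1) := div_nonneg (Real.sqrt_nonneg _) (pow_nonneg (Nat.cast_nonneg L) _)
  have h : ‖(1 - PiT L M k) * extGD L M S₀ D k‖ ≤ 2 * (d * L * (Real.sqrt (Cg * γ⁻¹) / (L : ℝ) ^ (k + 1))) :=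
    opNorm_one_sub_Pi_mul_le (lev L k) L M (extGD L M S₀ D k) hδ0 (fun ν => by exact hδ ν)
  refine h.trans (le_of_eq ?_)
  have hL : (L : ℝ) ≠ 0 := by exact_mod_cast NeZero.ne L
  rw [inv_pow, pow_succ]
  field_simp

/-- **THE COMPLEMENT LAW FOR AN ARBITRARY HERMITIAN REGION OPERATOR, from W1 + W2**:
`‖(D (k+1))⁻¹·(1 − J_kJ_kᴴ)_{ΩΩ}‖ ≤ 2d√(Cg·γ⁻¹)·L^{−k}`. [folklore] -/
theorem complement_le_of (hherm : (D (k + 1)).IsHermitian) {γ Cg : ℝ} (hγ : 0 < γ) (hCg : 0 ≤ Cg)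
    (hcoer : Coercive (D (k + 1)) γ)
    (hgrad : ∀ (ν : Fin d) (w : ridx L M S₀ (k + 1) → ℂ),
      nsq (fdiff (fine (lev L (k + 1)) M) ((lev L (k + 1) : ℕ) : ℂ) ν *ᵥ ext (inReg L M S₀ (k + 1)) w)
        ≤ Cg * (star w ⬝ᵥ (D (k + 1) *ᵥ w)).re) :
    ‖(D (k + 1))⁻¹ * (1 - JpcTR L M S₀ k * (JpcTR L M S₀ k)ᴴ)‖ ≤ 2 * d * Real.sqrt (Cg * γ⁻¹) * ((L : ℝ)⁻¹) ^ k := by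
  set p := inReg L M S₀ (k + 1) with hp
  set G := (D (k + 1))⁻¹ with hG
  set Y := (1 - PiT L M k).toBlock p p with hY
  have hJJ : 1 - JpcTR L M S₀ k * (JpcTR L M S₀ k)ᴴ = Y := by
    rw [JpcTR_mul_conjTranspose, hY, toBlock_sub, toBlock_one]
  rw [hJJ]
  have hGh : Gᴴ = G := hherm.inv
  have hPi : (1 - PiT L M k)ᴴ = 1 - PiT L M k := by
    rw [Matrix.conjTranspose_sub, Matrix.conjTranspose_one, PiT_conjTranspose]
  have hYh : Yᴴ = Y := by rw [hY, toBlock_conjTranspose, hPi]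
  have e1 : ‖G * Y‖ = ‖Y * G‖ := by
    rw [← Matrix.l2_opNorm_conjTranspose (G * Y), Matrix.conjTranspose_mul, hGh, hYh]
  rw [e1]
  have e2 : Y * G = sel p * ((1 - PiT L M k) * extGD L M S₀ D k) * (sel p)ᴴ := by
    have hvan : (1 - PiT L M k) * (sel p)ᴴ = (sel p)ᴴ * Y := by
      ext i b
      rw [mul_sel_conjTranspose_apply, Matrix.mul_apply]
      by_cases hi : p i
      · rw [Finset.sum_eq_single ⟨i, hi⟩]
        · simp [sel, hY, Matrix.toBlock_apply]
        · intro c _ hc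
          have : (sel p)ᴴ i c = 0 := by
            rw [Matrix.conjTranspose_apply]; simp only [sel]
            rw [if_neg, star_zero]; intro h; exact hc (Subtype.ext h)
          rw [this, zero_mul]
        · intro h; exact absurd (Finset.mem_univ _) h
      · have h0 : (1 - PiT L M k) i b = 0 := one_sub_Pi_vanish₂ L M S₀ k i b hi b.2
        rw [h0]
        symm
        refine Finset.sum_eq_zero fun c _ => ?_
        have : (sel p)ᴴ i c = 0 := by
          rw [Matrix.conjTranspose_apply]; simp only [sel]
          rw [if_neg, star_zero]; intro h; exact hi (h ▸ c.2)
        rw [this, zero_mul]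
    show Y * G = sel p * ((1 - PiT L M k) * ((sel p)ᴴ * G * sel p)) * (sel p)ᴴ
    calc Y * G = Y * G * (sel p * (sel p)ᴴ) := by rw [sel_mul_sel_conjTranspose, Matrix.mul_one]
      _ = ((sel p * (sel p)ᴴ) * Y) * G * (sel p * (sel p)ᴴ) := by rw [sel_mul_sel_conjTranspose, Matrix.one_mul]
      _ = sel p * (((sel p)ᴴ * Y) * G * sel p) * (sel p)ᴴ := by simp only [Matrix.mul_assoc]
      _ = sel p * (((1 - PiT L M k) * (sel p)ᴴ) * G * sel p) * (sel p)ᴴ := by rw [hvan]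
      _ = sel p * ((1 - PiT L M k) * ((sel p)ᴴ * G * sel p)) * (sel p)ᴴ := by simp only [Matrix.mul_assoc]
  rw [e2]
  calc ‖sel p * ((1 - PiT L M k) * extGD L M S₀ D k) * (sel p)ᴴ‖
      ≤ ‖sel p * ((1 - PiT L M k) * extGD L M S₀ D k)‖ * ‖(sel p)ᴴ‖ := Matrix.l2_opNorm_mul _ _
    _ ≤ ‖sel p‖ * ‖(1 - PiT L M k) * extGD L M S₀ D k‖ * ‖(sel p)ᴴ‖ :=
        mul_le_mul_of_nonneg_right (Matrix.l2_opNorm_mul _ _) (norm_nonneg _)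
    _ ≤ 1 * (2 * d * Real.sqrt (Cg * γ⁻¹) * ((L : ℝ)⁻¹) ^ k) * 1 := by
        rw [Matrix.l2_opNorm_conjTranspose]
        have hs := opNorm_sel_le p
        have hb := opNorm_one_sub_Pi_mul_extGD_le L M S₀ D k hγ hCg hcoer hgrad
        have h0 : 0 ≤ 2 * d * Real.sqrt (Cg * γ⁻¹) * ((L : ℝ)⁻¹) ^ k := (norm_nonneg _).trans hb
        exact mul_le_mul (mul_le_mul hs hb (norm_nonneg _) zero_le_one) hs (norm_nonneg _) (by rw [one_mul]; exact h0)
    _ = _ := by ring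

end Complement

/-! ## §2 The END for an arbitrary region operator -/

/-- **THE Ω-RESTRICTED FREE TOWER LAWS FOR AN ARBITRARY HERMITIAN OPERATOR FAMILY, MODULO W1–W3**: every bookkeeping field is a theorem
(gen 11's `QlevR`/`JpcTR` laws), the complement law comes from W1 + W2, the injected law is W3. [folklore] -/
theorem freeTowerLaws_region_of (hherm : ∀ k, (D k).IsHermitian) {γ Cg : ℝ} (hγ : 0 < γ) (hCg : 0 ≤ Cg)
    (hcoer : ∀ k, Coercive (D k) γ)
    (hgrad : ∀ (k : ℕ) (ν : Fin d) (w : ridx L M S₀ (k + 1) → ℂ),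
      nsq (fdiff (fine (lev L (k + 1)) M) ((lev L (k + 1) : ℕ) : ℂ) ν *ᵥ ext (inReg L M S₀ (k + 1)) w)
        ≤ Cg * (star w ⬝ᵥ (D (k + 1) *ᵥ w)).re)
    {e₁ : ℕ → ℝ} (hinj : ∀ k, ‖(D (k + 1))⁻¹ * JpcTR L M S₀ k - JpcTR L M S₀ k * (D k)⁻¹‖ ≤ e₁ k) :
    FreeTowerLaws D (QlevR L M S₀) (JpcTR L M S₀) (fun _ => 0) ((L : ℝ) ^ d)
      (fun k => 2 * d * Real.sqrt (Cg * γ⁻¹) * ((L : ℝ)⁻¹) ^ k) e₁ (fun _ => 0) where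
  isUnit_det := fun k => isUnit_det_of_coercive hγ (hcoer k)
  opNorm_A_sq_le := opNorm_QlevR_sq_le L M S₀
  opNorm_J_le := opNorm_JpcTR_le L M S₀
  A_mul_J := sqrt_smul_QlevR_mul_JpcTR L M S₀
  opNorm_F_mul_inv_le := fun k => by rw [Matrix.zero_mul, norm_zero]
  opNorm_inv_mul_F_le := fun k => by rw [Matrix.conjTranspose_zero, Matrix.mul_zero, norm_zero]
  complement_le := fun k => complement_le_of L M S₀ D k (hherm (k + 1)) hγ hCg (hcoer (k + 1)) (hgrad k)
  injected_le := hinj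

omit [NeZero L] hM [DecidablePred S₀] in
/-- the complement constant is nonnegative. [folklore] -/
theorem complementConst_nonneg (Cg γ : ℝ) : 0 ≤ 2 * d * Real.sqrt (Cg * γ⁻¹) := by positivity

/-- **CONVERGENCE MODULO W1–W3 AT ANY GEOMETRIC RATE `θ ∈ [L⁻¹, 1)`** (W3 with majorant `C₁θ^k`). [folklore] -/
theorem towerLimitRate_region_of (hherm : ∀ k, (D k).IsHermitian) {γ Cg : ℝ} (hγ : 0 < γ) (hCg : 0 ≤ Cg)
    (hcoer : ∀ k, Coercive (D k) γ)
    (hgrad : ∀ (k : ℕ) (ν : Fin d) (w : ridx L M S₀ (k + 1) → ℂ),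
      nsq (fdiff (fine (lev L (k + 1)) M) ((lev L (k + 1) : ℕ) : ℂ) ν *ᵥ ext (inReg L M S₀ (k + 1)) w)
        ≤ Cg * (star w ⬝ᵥ (D (k + 1) *ᵥ w)).re)
    {θ C₁ : ℝ} (hθ : ((L : ℝ)⁻¹) ≤ θ) (hθ1 : θ < 1)
    (hinj : ∀ k, ‖(D (k + 1))⁻¹ * JpcTR L M S₀ k - JpcTR L M S₀ k * (D k)⁻¹‖ ≤ C₁ * θ ^ k) :
    TowerLimitRate (QlevR L M S₀) ((L : ℝ) ^ d) (fun k => (D k)⁻¹) (Cpert 0 (2 * d * Real.sqrt (Cg * γ⁻¹)) C₁ 0 0 0) θ := by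
  have hr : (0 : ℝ) < (L : ℝ) ^ d := pow_pos (by exact_mod_cast Nat.pos_of_ne_zero (NeZero.ne L)) d
  have hC₀ := complementConst_nonneg (d := d) Cg γ
  have ht : ‖(0 : ℂ)‖ * 0 < 1 := by rw [norm_zero, zero_mul]; exact one_pos
  have h := towerLimitRate_perturbed hr (freeTowerLaws_region_of L M S₀ D hherm hγ hCg hcoer hgrad hinj)
    (perturbationLaws_zero (D := D) (J := JpcTR L M S₀)) hθ1
    (fun k => mul_le_mul_of_nonneg_left (pow_le_pow_left₀ (inv_nonneg.mpr (Nat.cast_nonneg L)) hθ k) hC₀)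
    (fun k => le_rfl) (fun k => by rw [zero_mul]) (fun k => by rw [zero_mul]) ht
  simp only [zero_smul, add_zero] at h
  exact h

/-- **THE RESOLVENT ROUTE OVER THE REGION FOR AN ARBITRARY FREE OPERATOR FAMILY** (modulo W1–W3): any compressed perturbation family with
`PerturbationLaws D P (JpcTR S₀) κ (k ↦ C₂θ^k)`, any `‖t‖κ < 1`. [folklore] -/
theorem towerLimitRate_region_perturbed_of (hherm : ∀ k, (D k).IsHermitian) {γ Cg : ℝ} (hγ : 0 < γ) (hCg : 0 ≤ Cg)
    (hcoer : ∀ k, Coercive (D k) γ)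
    (hgrad : ∀ (k : ℕ) (ν : Fin d) (w : ridx L M S₀ (k + 1) → ℂ),
      nsq (fdiff (fine (lev L (k + 1)) M) ((lev L (k + 1) : ℕ) : ℂ) ν *ᵥ ext (inReg L M S₀ (k + 1)) w)
        ≤ Cg * (star w ⬝ᵥ (D (k + 1) *ᵥ w)).re)
    {θ C₁ : ℝ} (hθ : ((L : ℝ)⁻¹) ≤ θ) (hθ1 : θ < 1)
    (hinj : ∀ k, ‖(D (k + 1))⁻¹ * JpcTR L M S₀ k - JpcTR L M S₀ k * (D k)⁻¹‖ ≤ C₁ * θ ^ k)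
    {P : (k : ℕ) → Matrix (ridx L M S₀ k) (ridx L M S₀ k) ℂ} {κ C₂ : ℝ}
    (hpert : PerturbationLaws D P (JpcTR L M S₀) κ (fun k => C₂ * θ ^ k)) {t : ℂ} (ht : ‖t‖ * κ < 1) :
    TowerLimitRate (QlevR L M S₀) ((L : ℝ) ^ d) (fun k => (D k + t • P k)⁻¹)
      (Cpert κ (2 * d * Real.sqrt (Cg * γ⁻¹)) C₁ C₂ 0 t) θ := by
  have hr : (0 : ℝ) < (L : ℝ) ^ d := pow_pos (by exact_mod_cast Nat.pos_of_ne_zero (NeZero.ne L)) d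
  have hC₀ := complementConst_nonneg (d := d) Cg γ
  exact towerLimitRate_perturbed hr (freeTowerLaws_region_of L M S₀ D hherm hγ hCg hcoer hgrad hinj) hpert hθ1
    (fun k => mul_le_mul_of_nonneg_left (pow_le_pow_left₀ (inv_nonneg.mpr (Nat.cast_nonneg L)) hθ k) hC₀)
    (fun k => le_rfl) (fun k => le_rfl) (fun k => by rw [zero_mul]) ht

/-! ## §3 Consistency: the torus-gauge model is the instance where W1 and W2 are theorems -/

variable (a : ℝ) (ha : 0 < a)

/-- W1 for the model: every compression of `Δ_a^{(k)}` is `((d+1)Cst)⁻¹`-coercive. [folklore] -/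
theorem coercive_DalevR (k : ℕ) : Coercive (DalevR L M a ha S₀ k) (gamD d a) :=
  coercive_toBlock _ (coercive_calDalev L M a ha k)

/-- W2 for the model: `‖∇_ν ext(w)‖² ≤ (d+1)Cst·Re⟨w, (Δ_a^{(k)})_{ΩΩ} w⟩` (B5's (1.89) through `form_toBlock`). [folklore] -/
theorem grad_form_DalevR (k : ℕ) (ν : Fin d) (w : ridx L M S₀ k → ℂ) :
    nsq (fdiff (fine (lev L k) M) ((lev L k : ℕ) : ℂ) ν *ᵥ ext (inReg L M S₀ k) w)
      ≤ ((d : ℝ) + 1) * Cst d a * (star w ⬝ᵥ (DalevR L M a ha S₀ k *ᵥ w)).re := by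
  have h := nsq_fdiff_le_form M a ha (lev L k) (one_le_lev' L k) ν (ext (inReg L M S₀ k) w)
  rw [DalevR, form_toBlock]
  exact h

/-- **CONSISTENCY**: the generic assembly applied to the model `DalevR` with its PROVED W1/W2 gives the Ω-restricted free tower laws
modulo the injected law with complement constant `2d·√((d+1)Cst·γ_D⁻¹)` — gen 11's `freeTowerLaws_dirichlet_of_injected` up to the
spelling of that constant (`γ_D⁻¹ = (d+1)Cst`). [folklore] -/
theorem freeTowerLaws_dalevR_of_injected' {e₁ : ℕ → ℝ}
    (hinj : ∀ k, ‖(DalevR L M a ha S₀ (k + 1))⁻¹ * JpcTR L M S₀ k - JpcTR L M S₀ k * (DalevR L M a ha S₀ k)⁻¹‖ ≤ e₁ k) :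
    FreeTowerLaws (DalevR L M a ha S₀) (QlevR L M S₀) (JpcTR L M S₀) (fun _ => 0) ((L : ℝ) ^ d)
      (fun k => 2 * d * Real.sqrt ((((d : ℝ) + 1) * Cst d a) * (gamD d a)⁻¹) * ((L : ℝ)⁻¹) ^ k) e₁ (fun _ => 0) :=
  freeTowerLaws_region_of L M S₀ (DalevR L M a ha S₀) (DalevR_isHermitian L M a ha S₀) (gamD_pos a) (K_pos (d := d) a).le
    (coercive_DalevR L M S₀ a ha) (fun k => grad_form_DalevR L M S₀ a ha (k + 1)) hinj

end Summit.QuantumFields.BalabanUV.T4Continuum.DirichletRegionTowerOf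

end
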